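import Summits.CriticalPhenomena.PercolationContinuityZ3.Theorems.PercNearOneGluingAdditiveGluingSandwichLemmaU
import Mathlib.Combinatorics.SetFamily.FourFunctions
import HarnessLib

/-!
# A sandwich extension of the van den Berg–Häggström–Kahn inequality — II: Theorem S

Crux `PercNearOneGluing.AdditiveGluing` (stmt-CriticalPhenomena-4576), line
`subuniform-dead-pocket-maximum`, stub `stub_goodStep` (siege seat k41, kernel C1); lands with
`--supports stmt-CriticalPhenomena-4576`.  No new definitions, no named facts.  Continues part I
(`…SandwichLemmaU.lean`: Lemma U, marginalisation, BHK's restriction for the observer).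

Notation as in part I: source `s`, observer `o`, `R_X = {s ↮ X}`, sandwich function
`g^(T)(ω) = 1{s ↔ o} + 1{s ↮ o} · h(C_o) · 1{o ↮ T}` for an ARBITRARY `h : Set (Sym2 V) → [0,1]`
(inside `U`: `if (openGraph (ω ∩ edgesIn U)).Reachable s o then 1 else h (rC U o ω) * ind (rD U o T) ω`,
passed to `coreS` as `g s U T ω` together with its defining equation).

* `coreS` (**Theorem S**, sandwich form of BHK 2006 Thm 1.1): for `F ≥ 0` increasing and all
  `X, Y ⊆ U`, `E[F(C_s) 1_{R_X}] · E[g^(Y) 1_{R_Y}] ≤ E[F(C_s) g^(X∩Y) 1_{R_{X∩Y}}] · P(R_{X∪Y})`,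
  by BHK's own induction on the vertex set (condition on the vertices joined to `Z = X ∩ Y` by an
  open edge; Ahlswede–Daykin `four_functions_theorem_univ`; `BHK2006.step_sum` and
  `step_sum_gen`); base case `X ∩ Y = ∅` by Harris twice and Lemma U twice.  BHK's Thm 1.1
  (`BHK2006.core`) is the case `h ≡ 0`.
* Part III (`…SandwichLemma3.lean`) derives Corollary H (`X = Y = {t}`: given `{s ↮ t}`, `F(C_s)`
  and `g = 1{s↔o} + 1{s↮o, o↮t} h(C_o)` are positively correlated for ANY `h : · → [0,1]`; the
  cases `h` monotone are BHK Thms 1.3/1.5 with source sets, general `h` is new — paper proof: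
  seat k41's PROOF-H.md attached to the crux item) and Kozma–Nitzan's Lemma 3 for ALL events of
  the observer's cluster between `{a₂ ∈ C(o)}` and `{a₁ ∉ C(o)}` (the kernel C1 of `stub_goodStep`).
-/

noncomputable section

open MeasureTheory unitInterval
open Literature.Probability.LatticeModels (prodBernoulli)
open Literature.Probability.Percolation
open Literature.Probability.Percolation.BHK2006

namespace Summit.CriticalPhenomena.PercolationContinuityZ3.Theorems

namespace SandwichK41

open scoped Classical
open DecisionTree (ind ind_of_mem ind_of_not_mem ind_nonneg)

variable {V : Type*} [Fintype V]

/-! ### Theorem S: the sandwich form of BHK's Theorem 1.1, by BHK's induction -/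

/-- **Theorem S (sandwich BHK 1.1), for percolation restricted to `U`.**  For `s, o ∈ U`,
`X, Y ⊆ U`, `F ≥ 0` increasing and the sandwich functions `g^(T)` of an arbitrary
`h : Set (Sym2 V) → [0,1]` (passed as `g s U T ω` with its defining equation `hg`),
`E[F(C_s) 1_{R_X}] · E[g^(Y) 1_{R_Y}] ≤ E[F(C_s) g^(X∩Y) 1_{R_{X∩Y}}] · P(R_{X∪Y})`.
Proof: BHK's induction on `U` (pp. 3–5) verbatim — condition on the vertices joined to
`Z = X ∩ Y` by an open edge, four functions theorem with the induction hypothesis — using that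
on `R_Y` the sandwich function `g^(Y)` of `G[U]` is the sandwich function `g^((Y∖Z) ∪ S)` of
`G[U∖Z]` (`sand_restrict`) and that `g^(T)` is antitone in `T`; the base case `X ∩ Y = ∅` is
Harris twice and Lemma U twice (`lemmaU_restrict`, once with `F` and once with `1{s ↔ Y}`).
[cite: VandenbergHaggstromKahn2005, Thm. 1.1 (pp. 3–5)] -/
theorem coreS (w : Sym2 V → ℝ) (hw0 : ∀ e, 0 ≤ w e) (hw1 : ∀ e, w e ≤ 1)
    (hm : ∑ ω, weight w ω = 1) (o : V) (h : Set (Sym2 V) → ℝ) (h0 : ∀ C, 0 ≤ h C)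
    (h1 : ∀ C, h C ≤ 1) (g : V → Finset V → Set V → Set (Sym2 V) → ℝ)
    (hg : ∀ s U T ω, g s U T ω = if (openGraph (ω ∩ edgesIn U)).Reachable s o then (1 : ℝ)
      else h (rC U o ω) * ind (rD U o T) ω)
    (U : Finset V) :
    ∀ (s : V), s ∈ U → o ∈ U → ∀ (X Y : Set V), X ⊆ ↑U → Y ⊆ ↑U →
    ∀ (F : Set (Sym2 V) → ℝ), Monotone F → (∀ a, 0 ≤ F a) →
    (∑ ω, weight w ω * (F (rC U s ω) * ind (rD U s X) ω)) *
      (∑ ω, weight w ω * (g s U Y ω * ind (rD U s Y) ω)) ≤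
    (∑ ω, weight w ω * (F (rC U s ω) * g s U (X ∩ Y) ω * ind (rD U s (X ∩ Y)) ω)) *
      (∑ ω, weight w ω * ind (rD U s (X ∪ Y)) ω) := by
  induction U using Finset.strongInduction with
  | H U ih =>
  intro s hsU hoU X Y hXU hYU F hF hF0
  -- bounds on the sandwich functions
  have g0 : ∀ (U' : Finset V) (T : Set V) ω, 0 ≤ g s U' T ω := fun U' T ω => by
    rw [hg]; exact sand_nonneg U' s o h0 T ω
  have gant : ∀ (U' : Finset V) (T T' : Set V), T ⊆ T' → ∀ ω, g s U' T' ω ≤ g s U' T ω :=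
    fun U' T T' hTT' ω => by rw [hg, hg]; exact sand_antitone U' s o h0 hTT' ω
  -- nonnegativity of the right-hand side
  have hRHS : 0 ≤ (∑ ω, weight w ω * (F (rC U s ω) * g s U (X ∩ Y) ω * ind (rD U s (X ∩ Y)) ω)) *
      (∑ ω, weight w ω * ind (rD U s (X ∪ Y)) ω) :=
    mul_nonneg (Finset.sum_nonneg fun ω _ => mul_nonneg (weight_nonneg hw0 hw1 ω)
      (mul_nonneg (mul_nonneg (hF0 _) (g0 _ _ _)) (ind_nonneg _ _)))
      (Finset.sum_nonneg fun ω _ => mul_nonneg (weight_nonneg hw0 hw1 ω) (ind_nonneg _ _))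
  -- trivial cases `s ∈ X`, `s ∈ Y`
  by_cases hsX : s ∈ X
  · have h0' : ∑ ω, weight w ω * (F (rC U s ω) * ind (rD U s X) ω) = 0 :=
      Finset.sum_eq_zero fun ω _ => by
        rw [rD_eq_empty hsX, ind_of_not_mem (Set.notMem_empty ω)]; ring
    rw [h0', zero_mul]; exact hRHS
  by_cases hsY : s ∈ Y
  · have h0' : ∑ ω, weight w ω * (g s U Y ω * ind (rD U s Y) ω) = 0 :=
      Finset.sum_eq_zero fun ω _ => by
        rw [rD_eq_empty hsY, ind_of_not_mem (Set.notMem_empty ω)]; ring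
    rw [h0', mul_zero]; exact hRHS
  -- `Z := X ∩ Y`
  set Z : Finset V := U.filter fun v => v ∈ X ∧ v ∈ Y with hZ
  have hZU : Z ⊆ U := Finset.filter_subset _ _
  have hmemZ : ∀ v, v ∈ Z ↔ v ∈ X ∧ v ∈ Y := fun v => by
    simp only [hZ, Finset.mem_filter, and_iff_right_iff_imp]
    exact fun h => hXU h.1
  have hsZ : s ∉ Z := fun h => hsX ((hmemZ s).1 h).1
  rcases Z.eq_empty_or_nonempty with hZe | hZne
  · /- `X ∩ Y = ∅`: Harris twice and Lemma U twice. -/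
    have hXYe : X ∩ Y = ∅ := Set.eq_empty_of_forall_notMem fun x hx => by
      have : x ∈ Z := (hmemZ x).2 hx
      rw [hZe] at this
      exact Finset.notMem_empty x this
    rw [hXYe]
    have hR0 : ∀ ω, ind (rD U s (∅ : Set V)) ω = 1 := fun ω =>
      ind_of_mem fun x hx _ => Set.notMem_empty x hx
    have hge : ∀ ω, g s U (∅ : Set V) ω =
        (if (openGraph (ω ∩ edgesIn U)).Reachable s o then (1 : ℝ) else h (rC U o ω)) :=
      fun ω => by rw [hg]; exact sand_empty U s o h ω
    have hXuY : ∀ ω, ind (rD U s (X ∪ Y)) ω = ind (rD U s X) ω * ind (rD U s Y) ω := fun ω => by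
      rw [rD_union, ind_inter]
    simp_rw [hR0, mul_one, hXuY]
    -- the quantities
    set EF := ∑ ω, weight w ω * F (rC U s ω) with hEF
    set PX := ∑ ω, weight w ω * ind (rD U s X) ω with hPX
    set PY := ∑ ω, weight w ω * ind (rD U s Y) ω with hPY
    set EG := ∑ ω, weight w ω * g s U (∅ : Set V) ω with hEG
    set B0 := ∑ ω, weight w ω * (g s U (∅ : Set V) ω * ind (rD U s Y) ω) with hB0
    set EFG := ∑ ω, weight w ω * (F (rC U s ω) * g s U (∅ : Set V) ω) with hEFG
    have hFm : Monotone fun ω => F (rC U s ω) := fun a b hab => hF (rC_mono U s hab)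
    -- (i) `g^(Y) ≤ g^(∅)`
    have hB : ∑ ω, weight w ω * (g s U Y ω * ind (rD U s Y) ω) ≤ B0 :=
      Finset.sum_le_sum fun ω _ => mul_le_mul_of_nonneg_left
        (mul_le_mul_of_nonneg_right (gant U ∅ Y (Set.empty_subset Y) ω) (ind_nonneg _ _))
        (weight_nonneg hw0 hw1 ω)
    -- (ii) Harris for `F` and `R_X`
    have hA : ∑ ω, weight w ω * (F (rC U s ω) * ind (rD U s X) ω) ≤ EF * PX :=
      harris_mono_anti hw0 hw1 hm (fun _ => hF0 _) hFm
        (ind_rD_antitone U s X) (fun _ => ind_le_one _ _)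
    -- (iii) Lemma U for `1{s ↔ Y}` and `g^(∅)`: `B0 ≤ EG * PY`
    have hB0 : B0 ≤ EG * PY := by
      set F' : Set (Sym2 V) → ℝ := fun C => if ∃ y ∈ Y, y = s ∨ ∃ e ∈ C, y ∈ e then 1 else 0
        with hF'
      have hF'm : Monotone F' := by
        intro C C' hCC'
        simp only [hF']
        by_cases hc : ∃ y ∈ Y, y = s ∨ ∃ e ∈ C, y ∈ e
        · have hc' : ∃ y ∈ Y, y = s ∨ ∃ e ∈ C', y ∈ e := by
            obtain ⟨y, hy, hy'⟩ := hc
            exact ⟨y, hy, hy'.imp id fun ⟨e, he, hye⟩ => ⟨e, hCC' he, hye⟩⟩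
          rw [if_pos hc, if_pos hc']
        · rw [if_neg hc]; split_ifs
          · exact zero_le_one
          · exact le_rfl
      have hF'e : ∀ ω, F' (rC U s ω) = 1 - ind (rD U s Y) ω := by
        intro ω
        simp only [hF']
        by_cases hω : ω ∈ rD U s Y
        · rw [ind_of_mem hω, if_neg]
          · ring
          · rintro ⟨y, hy, hy'⟩
            exact hω y hy ((reachable_iff_exists_mem_openEdgeCluster (ω ∩ edgesIn U) s y).2 hy')
        · rw [ind_of_not_mem hω, if_pos]
          · ring
          · simp only [rD, Set.mem_setOf_eq, not_forall, not_not] at hω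
            obtain ⟨y, hy, hr⟩ := hω
            exact ⟨y, hy, (reachable_iff_exists_mem_openEdgeCluster (ω ∩ edgesIn U) s y).1 hr⟩
      have key := lemmaU_restrict w hw0 hw1 hm U s o F' hF'm h h1
      simp_rw [← hge] at key
      have x1 : ∑ ω, weight w ω * F' (rC U s ω) = 1 - PY := by
        have := sum_affine w (fun ω => F' (rC U s ω)) (fun _ => 1) (ind (rD U s Y)) (ind (rD U s Y))
          (ind (rD U s Y)) 1 (-1) 0 0 (fun ω => by rw [hF'e]; ring)
        rw [this]; simp [hm]; ring
      have x2 : ∑ ω, weight w ω * (F' (rC U s ω) * g s U (∅ : Set V) ω) = EG - B0 := by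
        have := sum_affine w (fun ω => F' (rC U s ω) * g s U (∅ : Set V) ω) (g s U (∅ : Set V))
          (fun ω => g s U (∅ : Set V) ω * ind (rD U s Y) ω) (ind (rD U s Y)) (ind (rD U s Y))
          1 (-1) 0 0 (fun ω => by rw [hF'e]; ring)
        rw [this]; simp [hEG, hB0]; ring
      rw [x1, x2] at key
      nlinarith [key]
    -- (iv) Lemma U for `F` and `g^(∅)`
    have hFG : EF * EG ≤ EFG := by
      have key := lemmaU_restrict w hw0 hw1 hm U s o F hF h h1
      simp_rw [← hge] at key
      exact key
    -- (v) Harris for `R_X` and `R_Y`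
    have hP : PX * PY ≤ ∑ ω, weight w ω * (ind (rD U s X) ω * ind (rD U s Y) ω) :=
      harris_anti_anti hw0 hw1 hm (ind_rD_antitone U s X) (ind_rD_antitone U s Y)
        (fun _ => ind_le_one _ _) (fun _ => ind_le_one _ _)
    -- nonnegativity
    have hA1n : 0 ≤ ∑ ω, weight w ω * (F (rC U s ω) * ind (rD U s X) ω) :=
      sum_ind_nonneg hw0 hw1 (fun _ => hF0 _) _
    have hB0n : 0 ≤ B0 := sum_ind_nonneg hw0 hw1 (fun ω => g0 U ∅ ω) _
    have hEFn : 0 ≤ EF := Finset.sum_nonneg fun ω _ => mul_nonneg (weight_nonneg hw0 hw1 ω) (hF0 _)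
    have hEGn : 0 ≤ EG := Finset.sum_nonneg fun ω _ => mul_nonneg (weight_nonneg hw0 hw1 ω) (g0 _ _ _)
    have hPXn : 0 ≤ PX := Finset.sum_nonneg fun ω _ => mul_nonneg (weight_nonneg hw0 hw1 ω) (ind_nonneg _ _)
    have hPYn : 0 ≤ PY := Finset.sum_nonneg fun ω _ => mul_nonneg (weight_nonneg hw0 hw1 ω) (ind_nonneg _ _)
    have hEFGn : 0 ≤ EFG := Finset.sum_nonneg fun ω _ => mul_nonneg (weight_nonneg hw0 hw1 ω)
      (mul_nonneg (hF0 _) (g0 _ _ _))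
    calc (∑ ω, weight w ω * (F (rC U s ω) * ind (rD U s X) ω)) *
          (∑ ω, weight w ω * (g s U Y ω * ind (rD U s Y) ω))
        ≤ (∑ ω, weight w ω * (F (rC U s ω) * ind (rD U s X) ω)) * B0 :=
          mul_le_mul_of_nonneg_left hB hA1n
      _ ≤ (EF * PX) * (EG * PY) := mul_le_mul hA hB0 hB0n (mul_nonneg hEFn hPXn)
      _ = (EF * EG) * (PX * PY) := by ring
      _ ≤ EFG * ∑ ω, weight w ω * (ind (rD U s X) ω * ind (rD U s Y) ω) :=
          mul_le_mul hFG hP (mul_nonneg hPXn hPYn) hEFGn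
  · by_cases hoZ : o ∈ Z
    · /- `o ∈ Z ⊆ Y`: the sandwich factor vanishes on `R_Y`. -/
      have hoY : o ∈ Y := ((hmemZ o).1 hoZ).2
      have h0' : ∑ ω, weight w ω * (g s U Y ω * ind (rD U s Y) ω) = 0 := by
        refine Finset.sum_eq_zero fun ω _ => ?_
        by_cases hω : ω ∈ rD U s Y
        · have hns : ¬ (openGraph (ω ∩ edgesIn U)).Reachable s o := hω o hoY
          have hno : ω ∉ rD U o Y := fun h' => h' o hoY (SimpleGraph.Reachable.refl o)
          rw [hg, if_neg hns, ind_of_not_mem hno]; ring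
        · rw [ind_of_not_mem hω]; ring
      rw [h0', mul_zero]; exact hRHS
    /- `Z ≠ ∅`, `o ∉ Z`: condition on `S` and apply the four functions theorem with the
    induction hypothesis on `U ∖ Z` (BHK pp. 4–5). -/
    have hss : U \ Z ⊂ U := Finset.sdiff_ssubset hZU hZne
    have hsU' : s ∈ U \ Z := Finset.mem_sdiff.2 ⟨hsU, hsZ⟩
    have hoU' : o ∈ U \ Z := Finset.mem_sdiff.2 ⟨hoU, hoZ⟩
    have hZX : (↑Z : Set V) ⊆ X := fun v hv => ((hmemZ v).1 hv).1
    have hZY : (↑Z : Set V) ⊆ Y := fun v hv => ((hmemZ v).1 hv).2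
    have hZXY : (↑Z : Set V) ⊆ X ∩ Y := fun v hv => (hmemZ v).1 hv
    have hZXuY : (↑Z : Set V) ⊆ X ∪ Y := fun v hv => Or.inl (((hmemZ v).1 hv).1)
    -- the four sums, conditioned on `S`
    have e1 := step_sum hZU hsZ hZX w hm F
    have e2 : ∑ ω, weight w ω * (g s U Y ω * ind (rD U s Y) ω) =
        ∑ ω, weight w ω * ∑ η, weight w η * (g s (U \ Z) ((Y \ ↑Z) ∪ rS U Z ω) η *
          ind (rD (U \ Z) s ((Y \ ↑Z) ∪ rS U Z ω)) η) := by
      refine step_sum_gen w hm _ (fun T η => g s (U \ Z) ((Y \ ↑Z) ∪ T) η *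
        ind (rD (U \ Z) s ((Y \ ↑Z) ∪ T)) η) (fun ω => ?_) (fun T η => ?_)
      · rw [hg s (U \ Z), sand_diff_meeting, ind_rD_diff_meeting, ← hg]
        by_cases hω : ω ∈ rD U s Y
        · have hω' : ω ∈ rD (U \ Z) s ((Y \ ↑Z) ∪ rS U Z ω) := (mem_rD_iff_restrict hZU hsZ hZY ω).1 hω
          have hS : ∀ n ∈ rS U Z ω, ¬ (openGraph (ω ∩ edgesIn (U \ Z))).Reachable s n :=
            fun n hn => hω' n (Or.inr hn)
          rw [ind_of_mem hω, ind_of_mem hω', hg, hg, sand_restrict hZU hsZ hoZ h hZY hS]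
        · rw [ind_of_not_mem hω, ind_of_not_mem (fun h' => hω ((mem_rD_iff_restrict hZU hsZ hZY ω).2 h')),
            mul_zero, mul_zero]
      · rw [hg s (U \ Z), sand_diff_meeting, ind_rD_diff_meeting, ← hg]
    have e3 : ∑ ω, weight w ω * (F (rC U s ω) * g s U (X ∩ Y) ω * ind (rD U s (X ∩ Y)) ω) =
        ∑ ω, weight w ω * ∑ η, weight w η * (F (rC (U \ Z) s η) *
          g s (U \ Z) (((X ∩ Y) \ ↑Z) ∪ rS U Z ω) η *
          ind (rD (U \ Z) s (((X ∩ Y) \ ↑Z) ∪ rS U Z ω)) η) := by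
      refine step_sum_gen w hm _ (fun T η => F (rC (U \ Z) s η) *
        g s (U \ Z) (((X ∩ Y) \ ↑Z) ∪ T) η * ind (rD (U \ Z) s (((X ∩ Y) \ ↑Z) ∪ T)) η)
        (fun ω => ?_) (fun T η => ?_)
      · rw [hg s (U \ Z), sand_diff_meeting, ind_rD_diff_meeting, rC_diff_meeting, ← hg]
        by_cases hω : ω ∈ rD U s (X ∩ Y)
        · have hω' : ω ∈ rD (U \ Z) s (((X ∩ Y) \ ↑Z) ∪ rS U Z ω) :=
            (mem_rD_iff_restrict hZU hsZ hZXY ω).1 hω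
          have hS : ∀ n ∈ rS U Z ω, ¬ (openGraph (ω ∩ edgesIn (U \ Z))).Reachable s n :=
            fun n hn => hω' n (Or.inr hn)
          rw [ind_of_mem hω, ind_of_mem hω', hg, hg, sand_restrict hZU hsZ hoZ h hZXY hS,
            rC_restrict hsZ hS]
        · rw [ind_of_not_mem hω, ind_of_not_mem (fun h' => hω ((mem_rD_iff_restrict hZU hsZ hZXY ω).2 h')),
            mul_zero, mul_zero]
      · rw [hg s (U \ Z), sand_diff_meeting, ind_rD_diff_meeting, rC_diff_meeting, ← hg]
    have e4 : ∑ ω, weight w ω * ind (rD U s (X ∪ Y)) ω =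
        ∑ ω, weight w ω * blockE w (U \ Z) s (fun _ => 1) ((X ∪ Y) \ ↑Z) (rS U Z ω) := by
      have := step_sum hZU hsZ hZXuY w hm (fun _ => 1)
      simpa only [one_mul] using this
    rw [e1, e2, e3, e4]
    refine four_functions_theorem_univ
      (fun ω => weight w ω * blockE w (U \ Z) s F (X \ ↑Z) (rS U Z ω))
      (fun ω => weight w ω * ∑ η, weight w η * (g s (U \ Z) ((Y \ ↑Z) ∪ rS U Z ω) η *
          ind (rD (U \ Z) s ((Y \ ↑Z) ∪ rS U Z ω)) η))
      (fun ω => weight w ω * ∑ η, weight w η * (F (rC (U \ Z) s η) *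
          g s (U \ Z) (((X ∩ Y) \ ↑Z) ∪ rS U Z ω) η *
          ind (rD (U \ Z) s (((X ∩ Y) \ ↑Z) ∪ rS U Z ω)) η))
      (fun ω => weight w ω * blockE w (U \ Z) s (fun _ => 1) ((X ∪ Y) \ ↑Z) (rS U Z ω))
      (fun ω => mul_nonneg (weight_nonneg hw0 hw1 ω) (blockE_nonneg hw0 hw1 _ _ hF0 _ _))
      (fun ω => mul_nonneg (weight_nonneg hw0 hw1 ω) (Finset.sum_nonneg fun η _ =>
        mul_nonneg (weight_nonneg hw0 hw1 η) (mul_nonneg (g0 _ _ _) (ind_nonneg _ _))))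
      (fun ω => mul_nonneg (weight_nonneg hw0 hw1 ω) (Finset.sum_nonneg fun η _ =>
        mul_nonneg (weight_nonneg hw0 hw1 η)
          (mul_nonneg (mul_nonneg (hF0 _) (g0 _ _ _)) (ind_nonneg _ _))))
      (fun ω => mul_nonneg (weight_nonneg hw0 hw1 ω)
        (blockE_nonneg hw0 hw1 _ _ (fun _ => zero_le_one) _ _))
      fun a b => ?_
    -- the Ahlswede–Daykin hypothesis: weight lattice identity × induction hypothesis
    set Sa := rS U Z a with hSa
    set Sb := rS U Z b with hSb
    have hSaU : Sa ⊆ ↑(U \ Z) := rS_subset U Z a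
    have hSbU : Sb ⊆ ↑(U \ Z) := rS_subset U Z b
    have hX1 : X \ ↑Z ∪ Sa ⊆ ↑(U \ Z) := Set.union_subset
      (fun v hv => by rw [Finset.coe_sdiff]; exact ⟨hXU hv.1, hv.2⟩) hSaU
    have hY1 : Y \ ↑Z ∪ Sb ⊆ ↑(U \ Z) := Set.union_subset
      (fun v hv => by rw [Finset.coe_sdiff]; exact ⟨hYU hv.1, hv.2⟩) hSbU
    have IH := ih (U \ Z) hss s hsU' hoU' (X \ ↑Z ∪ Sa) (Y \ ↑Z ∪ Sb) hX1 hY1 F hF hF0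
    -- monotonicity in the conditioning sets
    have hsub3 : (X ∩ Y) \ ↑Z ∪ rS U Z (a ∩ b) ⊆ (X \ ↑Z ∪ Sa) ∩ (Y \ ↑Z ∪ Sb) := by
      refine Set.union_subset (fun v hv => ⟨Or.inl ⟨hv.1.1, hv.2⟩, Or.inl ⟨hv.1.2, hv.2⟩⟩) ?_
      exact fun v hv =>
        ⟨Or.inr (rS_inter_subset U Z a b hv).1, Or.inr (rS_inter_subset U Z a b hv).2⟩
    have hsub4 : (X ∪ Y) \ ↑Z ∪ rS U Z (a ∪ b) ⊆ (X \ ↑Z ∪ Sa) ∪ (Y \ ↑Z ∪ Sb) := by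
      rw [rS_union]
      rintro v (⟨hXY | hXY, hvZ⟩ | hS | hS)
      · exact Or.inl (Or.inl ⟨hXY, hvZ⟩)
      · exact Or.inr (Or.inl ⟨hXY, hvZ⟩)
      · exact Or.inl (Or.inr hS)
      · exact Or.inr (Or.inr hS)
    have h3 : ∑ η, weight w η * (F (rC (U \ Z) s η) * g s (U \ Z) ((X \ ↑Z ∪ Sa) ∩ (Y \ ↑Z ∪ Sb)) η *
        ind (rD (U \ Z) s ((X \ ↑Z ∪ Sa) ∩ (Y \ ↑Z ∪ Sb))) η) ≤
        ∑ η, weight w η * (F (rC (U \ Z) s η) * g s (U \ Z) (((X ∩ Y) \ ↑Z) ∪ rS U Z (a ∩ b)) η *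
          ind (rD (U \ Z) s (((X ∩ Y) \ ↑Z) ∪ rS U Z (a ∩ b))) η) :=
      Finset.sum_le_sum fun η _ => mul_le_mul_of_nonneg_left
        (mul_le_mul (mul_le_mul_of_nonneg_left (gant _ _ _ hsub3 η) (hF0 _))
          (ind_mono (rD_antitone hsub3) η) (ind_nonneg _ _) (mul_nonneg (hF0 _) (g0 _ _ _)))
        (weight_nonneg hw0 hw1 η)
    have h4 : ∑ ω, weight w ω * ind (rD (U \ Z) s ((X \ ↑Z ∪ Sa) ∪ (Y \ ↑Z ∪ Sb))) ω ≤
        blockE w (U \ Z) s (fun _ => 1) ((X ∪ Y) \ ↑Z) (rS U Z (a ∪ b)) := by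
      have := sum_ind_mono hw0 hw1 (h := fun _ => (1 : ℝ)) (fun _ => zero_le_one)
        (rD_antitone (U := U \ Z) (s := s) hsub4) (w := w)
      simp only [one_mul] at this
      simpa only [blockE, one_mul] using this
    have hn3 : 0 ≤ ∑ η, weight w η * (F (rC (U \ Z) s η) *
        g s (U \ Z) ((X \ ↑Z ∪ Sa) ∩ (Y \ ↑Z ∪ Sb)) η *
        ind (rD (U \ Z) s ((X \ ↑Z ∪ Sa) ∩ (Y \ ↑Z ∪ Sb))) η) :=
      Finset.sum_nonneg fun η _ => mul_nonneg (weight_nonneg hw0 hw1 η)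
        (mul_nonneg (mul_nonneg (hF0 _) (g0 _ _ _)) (ind_nonneg _ _))
    have hIH' : blockE w (U \ Z) s F (X \ ↑Z) Sa *
        (∑ η, weight w η * (g s (U \ Z) ((Y \ ↑Z) ∪ Sb) η * ind (rD (U \ Z) s ((Y \ ↑Z) ∪ Sb)) η)) ≤
        (∑ η, weight w η * (F (rC (U \ Z) s η) * g s (U \ Z) (((X ∩ Y) \ ↑Z) ∪ rS U Z (a ∩ b)) η *
          ind (rD (U \ Z) s (((X ∩ Y) \ ↑Z) ∪ rS U Z (a ∩ b))) η)) *
          blockE w (U \ Z) s (fun _ => 1) ((X ∪ Y) \ ↑Z) (rS U Z (a ∪ b)) :=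
      IH.trans (mul_le_mul h3 h4 (Finset.sum_nonneg fun ω _ =>
        mul_nonneg (weight_nonneg hw0 hw1 ω) (ind_nonneg _ _))
        (hn3.trans h3))
    have hwab := weight_inter_mul_union w a b
    show weight w a * blockE w (U \ Z) s F (X \ ↑Z) Sa *
        (weight w b * ∑ η, weight w η * (g s (U \ Z) ((Y \ ↑Z) ∪ Sb) η *
          ind (rD (U \ Z) s ((Y \ ↑Z) ∪ Sb)) η)) ≤
      weight w (a ∩ b) * (∑ η, weight w η * (F (rC (U \ Z) s η) *
          g s (U \ Z) (((X ∩ Y) \ ↑Z) ∪ rS U Z (a ∩ b)) η *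
          ind (rD (U \ Z) s (((X ∩ Y) \ ↑Z) ∪ rS U Z (a ∩ b))) η)) *
        (weight w (a ∪ b) * blockE w (U \ Z) s (fun _ => 1) ((X ∪ Y) \ ↑Z) (rS U Z (a ∪ b)))
    calc weight w a * blockE w (U \ Z) s F (X \ ↑Z) Sa *
          (weight w b * ∑ η, weight w η * (g s (U \ Z) ((Y \ ↑Z) ∪ Sb) η *
            ind (rD (U \ Z) s ((Y \ ↑Z) ∪ Sb)) η))
        = (weight w a * weight w b) * (blockE w (U \ Z) s F (X \ ↑Z) Sa *
            ∑ η, weight w η * (g s (U \ Z) ((Y \ ↑Z) ∪ Sb) η *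
              ind (rD (U \ Z) s ((Y \ ↑Z) ∪ Sb)) η)) := by ring
      _ ≤ (weight w (a ∩ b) * weight w (a ∪ b)) *
          ((∑ η, weight w η * (F (rC (U \ Z) s η) *
              g s (U \ Z) (((X ∩ Y) \ ↑Z) ∪ rS U Z (a ∩ b)) η *
              ind (rD (U \ Z) s (((X ∩ Y) \ ↑Z) ∪ rS U Z (a ∩ b))) η)) *
            blockE w (U \ Z) s (fun _ => 1) ((X ∪ Y) \ ↑Z) (rS U Z (a ∪ b))) := by
          rw [hwab]
          exact mul_le_mul_of_nonneg_left hIH'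
            (mul_nonneg (weight_nonneg hw0 hw1 _) (weight_nonneg hw0 hw1 _))
      _ = _ := by ring

end SandwichK41

/-! ### Registered stub form (siege k41) -/

open scoped Classical in
open SandwichK41 DecisionTree in
/-- **Registered stub `stub_sandwichCoreS_k41`** (= `SandwichK41.coreS` on `Fin n`): Theorem S,
the sandwich form of BHK 2006 Thm 1.1 for percolation restricted to `U ⊆ Fin n`.
[cite: VandenbergHaggstromKahn2005, Thm. 1.1 (pp. 3–5)] -/
theorem stub_sandwichCoreS_k41 : ∀ (n : ℕ) (w : Sym2 (Fin n) → ℝ), (∀ e, 0 ≤ w e) → (∀ e, w e ≤ 1) → ∑ ω, BHK2006.weight w ω = 1 → ∀ (o : Fin n) (h : Set (Sym2 (Fin n)) → ℝ), (∀ C, 0 ≤ h C) → (∀ C, h C ≤ 1) → ∀ (g : Fin n → Finset (Fin n) → Set (Fin n) → Set (Sym2 (Fin n)) → ℝ), (∀ s U T ω, g s U T ω = if (openGraph (ω ∩ BHK2006.edgesIn U)).Reachable s o then (1 : ℝ) else h (BHK2006.rC U o ω) * DecisionTree.ind (BHK2006.rD U o T) ω) → ∀ (U : Finset (Fin n)) (s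 : Fin n), s ∈ U → o ∈ U → ∀ (X Y : Set (Fin n)), X ⊆ ↑U → Y ⊆ ↑U → ∀ (F : Set (Sym2 (Fin n)) → ℝ), Monotone F → (∀ a, 0 ≤ F a) → (∑ ω, BHK2006.weight w ω * (F (BHK2006.rC U s ω) * DecisionTree.ind (BHK2006.rD U s X) ω)) * (∑ ω, BHK2006.weight w ω * (g s U Y ω * DecisionTree.ind (BHK2006.rD U s Y) ω)) ≤ (∑ ω, BHK2006.weight w ω * (F (BHK2006.rC U s ω) * g s U (X ∩ Y) ω * DecisionTree.ind (BHK2006.rD U s (X ∩ Y)) ω)) * (∑ ω, BHK2006.weight w ω * DecisionTree.ind (BHK2006.rD U s (X ∪ Y)) ω) :=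
  fun _ w hw0 hw1 hm o h h0 h1 g hg U s hsU hoU X Y hXU hYU F hF hF0 =>
    coreS w hw0 hw1 hm o h h0 h1 g (fun s' U' T ω => by rw [hg]; congr) U s hsU hoU X Y hXU hYU F hF hF0

end Summit.CriticalPhenomena.PercolationContinuityZ3.Theorems
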